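import Summits.HodgeConjecture.CorCM.D2Bridge.Thm418CSemilinearTransport
import HarnessLib

/-!
# Δ2 BRIDGE, PROPOSAL T glue (T0) — the semilinear transport frame with the WEAK `res`-law (`hres` on `Kof K`-fixed vectors only)

Cell pub-hodgecm2 (COR-CM), seat wb-11 gen 3 (prover-pub-hodgecm2-d2bridge-wb-11-g3-0), 2026-08-23.  Sequel to wb-11's
`D2Bridge/Thm418CSemilinearTransport.lean` (σ-semilinear transport of `Thm418Combined` ∕ `LiuDictionary.Thm418C`), repairing the seam
found by rekey-l0-instlevel-a g1 (HOME/INBOX l.12248) in all three transport frames (wb-10 linear, wb-5 conjugate-linear, wb-11 semilinear):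

At the model, `(LiuDictionary.ofTower …).res K` is an ARBITRARY `ℂ`-linear left inverse off the `K`-fixed vectors (`TowerRes.toLevel` is a
`Classical.choose`), so the ∀-`x` law `eW K (res K x) = res' (eL K) (eH x)` displayed by those frames has no inhabitant for a tower-built
`eH` (e.g. `F∞ = conj ⊗ id`).  The proofs use that law ONLY at a block vector already known to be `Kof K`-fixed, so every consumer-facing
head is re-issued here with `hres : ∀ K x, x ∈ fixedBy (Kof K) H → eW K (res K x) = res' (eL K) (eH x)`; this weak law IS inhabited at
the model (`fixedBy = levelImage`, `res ∘ ofLevel = id`, and the level-wise law).  Proofs = the parent file's with the one extra token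
`hres K x hxf`.  Over an inverse pair `σ σ' : ℂ →+* ℂ` (`[RingHomInvPair σ σ'] [RingHomInvPair σ' σ]`), so `σ := RingHom.id ℂ` is the
linear frame's repair and `σ := starRingEnd ℂ` the conjugate-linear one's.

* §1 (abstract): `thm418Combined_of_semilinearTransport_fixed`, `thm418Combined_semilinearTransport_of_fixed`,
  `thm418Combined_iff_of_semilinearTransport_fixed`.
* §2 (model): `thm418C_iff_of_semilinearTransport_fixed`, `thm418C_of_semilinearTransport_fixed`,
  `thm418C_iff_of_semilinearTransport_samePin_fixed`.

Kernel only; no instance, no named fact, no definition; orientation-neutral; HC_CM is NOT proved; «Δ2 BRIDGE CLOSED» is NOT claimed.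
-/

set_option autoImplicit false

noncomputable section

namespace HodgeCM.Literature.Theta.LiuAlbaneseModuleDatum.D2Bridge

open HodgeCM.Literature.Theta HodgeCM.Literature.Theta.LiuAlbaneseModuleDatum

universe u₃ v₃ w₃ u₃' v₃' w₃'

section AbstractSemilinearFixed

variable {σ σ' : ℂ →+* ℂ} [RingHomInvPair σ σ'] [RingHomInvPair σ' σ]
variable {G : Type u₃} [Group G] {Lvl : Type v₃} {Kof : Lvl → Subgroup G}
variable {G' : Type u₃'} [Group G'] {Lvl' : Type v₃'} {Kof' : Lvl' → Subgroup G'}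

omit [RingHomInvPair σ' σ] in
/-- **`Thm418Combined` transports along semilinear maps (pull-back form), WEAK `res`-law**: as `thm418Combined_of_semilinearTransport`, but
`hres` is required only on `Kof K`-fixed vectors — `∀ K x, x ∈ fixedBy (Kof K) H → eW K (res K x) = res' (eL K) (eH x)` — which is
all the proof uses (the block vector it chases is `Kof K`-fixed by hypothesis). [folklore] -/
theorem thm418Combined_of_semilinearTransport_fixed [Preorder Lvl] [Preorder Lvl']
    (D : LiuAlbaneseModuleDatum G Kof) (D' : LiuAlbaneseModuleDatum G' Kof')
    {W : Lvl → Type w₃} [∀ K, AddCommGroup (W K)] [∀ K, Module ℂ (W K)]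
    {W' : Lvl' → Type w₃'} [∀ K', AddCommGroup (W' K')] [∀ K', Module ℂ (W' K')]
    (res : ∀ K : Lvl, D.H →ₗ[ℂ] W K) (cmCl : ∀ K : Lvl, D.Char → Set (W K))
    (res' : ∀ K' : Lvl', D'.H →ₗ[ℂ] W' K') (cmCl' : ∀ K' : Lvl', D'.Char → Set (W' K'))
    (φ : G → G') (eL : Lvl → Lvl') (eC : D.Char → D'.Char) (eH : D.H →ₛₗ[σ] D'.H)
    (eW : ∀ K : Lvl, W K →ₛₗ[σ] W' (eL K))
    (hcof : ∀ K₀' : Lvl', ∃ K₀ : Lvl, ∀ K ≤ K₀, eL K ≤ K₀')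
    (hK : ∀ (K : Lvl), ∀ k' ∈ Kof' (eL K), ∃ k ∈ Kof K, φ k = k')
    (heH : ∀ (K : Lvl), ∀ k ∈ Kof K, ∀ x : D.H,
      eH (MonoidAlgebra.of ℂ G k • x) = MonoidAlgebra.of ℂ G' (φ k) • eH x)
    (hPhi : ∀ μ : D.Char, D.PhiMu μ → D'.PhiMu (eC μ))
    (hblock : ∀ μ : D.Char, (D.block μ).map eH ≤ D'.block (eC μ))
    (hres : ∀ (K : Lvl) (x : D.H), x ∈ fixedBy (Kof K) D.H → eW K (res K x) = res' (eL K) (eH x))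
    (hW : ∀ K : Lvl, Function.Injective (eW K))
    (hcm : ∀ (K : Lvl) (μ : D.Char), cmCl' (eL K) (eC μ) ⊆ eW K '' cmCl K μ)
    (h : D'.Thm418Combined res' cmCl') : D.Thm418Combined res cmCl := by
  intro μ hμ
  obtain ⟨K₀', hK₀'⟩ := h (eC μ) (hPhi μ hμ)
  obtain ⟨K₀, hK₀⟩ := hcof K₀'
  refine ⟨K₀, fun K hKle x hxb hxf => ?_⟩
  have h1 : eH x ∈ D'.block (eC μ) := hblock μ ⟨x, hxb, rfl⟩
  have h2 : eH x ∈ fixedBy (Kof' (eL K)) D'.H := map_mem_fixedBy_of_semilinearMap φ eH (hK K) (heH K) hxf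
  have h3 : eW K (res K x) ∈ (Submodule.span ℂ (cmCl K μ)).map (eW K) := by
    rw [Submodule.map_span, hres K x hxf]
    exact Submodule.span_mono (hcm K μ) (hK₀' (eL K) (hK₀ K hKle) (eH x) h1 h2)
  obtain ⟨y, hy, hyx⟩ := h3
  rwa [← hW K hyx]

/-- **`Thm418Combined` transports along semilinear maps (push-forward form), WEAK `res`-law**: as
`thm418Combined_semilinearTransport_of` with `hres` required only on `Kof K`-fixed vectors. [folklore] -/
theorem thm418Combined_semilinearTransport_of_fixed [Preorder Lvl] [Preorder Lvl']
    (D : LiuAlbaneseModuleDatum G Kof) (D' : LiuAlbaneseModuleDatum G' Kof')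
    {W : Lvl → Type w₃} [∀ K, AddCommGroup (W K)] [∀ K, Module ℂ (W K)]
    {W' : Lvl' → Type w₃'} [∀ K', AddCommGroup (W' K')] [∀ K', Module ℂ (W' K')]
    (res : ∀ K : Lvl, D.H →ₗ[ℂ] W K) (cmCl : ∀ K : Lvl, D.Char → Set (W K))
    (res' : ∀ K' : Lvl', D'.H →ₗ[ℂ] W' K') (cmCl' : ∀ K' : Lvl', D'.Char → Set (W' K'))
    (φ : G → G') (eL : Lvl ≃o Lvl') (eC : D.Char → D'.Char) (hC : Function.Surjective eC)
    (eH : D.H ≃ₛₗ[σ] D'.H) (eW : ∀ K : Lvl, W K →ₛₗ[σ] W' (eL K))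
    (hK : ∀ (K : Lvl), ∀ k ∈ Kof K, φ k ∈ Kof' (eL K))
    (heH : ∀ (K : Lvl), ∀ k ∈ Kof K, ∀ x : D.H,
      eH (MonoidAlgebra.of ℂ G k • x) = MonoidAlgebra.of ℂ G' (φ k) • eH x)
    (hPhi : ∀ μ : D.Char, D'.PhiMu (eC μ) → D.PhiMu μ)
    (hblock : ∀ μ : D.Char, D'.block (eC μ) ≤ (D.block μ).map (eH : D.H →ₛₗ[σ] D'.H))
    (hres : ∀ (K : Lvl) (x : D.H), x ∈ fixedBy (Kof K) D.H → eW K (res K x) = res' (eL K) (eH x))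
    (hcm : ∀ (K : Lvl) (μ : D.Char), eW K '' cmCl K μ ⊆ cmCl' (eL K) (eC μ))
    (h : D.Thm418Combined res cmCl) : D'.Thm418Combined res' cmCl' := by
  intro μ' hμ'
  obtain ⟨μ, rfl⟩ := hC μ'
  obtain ⟨K₀, hK₀⟩ := h μ (hPhi μ hμ')
  refine ⟨eL K₀, fun K' hK'le x' hxb' hxf' => ?_⟩
  obtain ⟨K, rfl⟩ := eL.surjective K'
  obtain ⟨x, rfl⟩ := eH.surjective x'
  have hKle : K ≤ K₀ := eL.le_iff_le.mp hK'le
  have hxb : x ∈ D.block μ := by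
    obtain ⟨y, hy, hyx⟩ := hblock μ hxb'
    rwa [← eH.injective hyx]
  have hxf : x ∈ fixedBy (Kof K) D.H := by
    intro k hk
    apply eH.injective
    rw [heH K k hk]
    exact hxf' (φ k) (hK K k hk)
  have h3 : eW K (res K x) ∈ (Submodule.span ℂ (cmCl K μ)).map (eW K) := ⟨_, hK₀ K hKle x hxb hxf, rfl⟩
  rw [Submodule.map_span, hres K x hxf] at h3
  exact Submodule.span_mono (hcm K μ) h3

/-- **`Thm418Combined` is INVARIANT under semilinear transport of all its data, WEAK `res`-law**: as
`thm418Combined_iff_of_semilinearTransport` with `hres` required only on `Kof K`-fixed vectors. [folklore] -/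
theorem thm418Combined_iff_of_semilinearTransport_fixed [Preorder Lvl] [Preorder Lvl']
    (D : LiuAlbaneseModuleDatum G Kof) (D' : LiuAlbaneseModuleDatum G' Kof')
    {W : Lvl → Type w₃} [∀ K, AddCommGroup (W K)] [∀ K, Module ℂ (W K)]
    {W' : Lvl' → Type w₃'} [∀ K', AddCommGroup (W' K')] [∀ K', Module ℂ (W' K')]
    (res : ∀ K : Lvl, D.H →ₗ[ℂ] W K) (cmCl : ∀ K : Lvl, D.Char → Set (W K))
    (res' : ∀ K' : Lvl', D'.H →ₗ[ℂ] W' K') (cmCl' : ∀ K' : Lvl', D'.Char → Set (W' K'))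
    (φ : G ≃* G') (eL : Lvl ≃o Lvl') (eC : D.Char ≃ D'.Char) (eH : D.H ≃ₛₗ[σ] D'.H)
    (eW : ∀ K : Lvl, W K ≃ₛₗ[σ] W' (eL K))
    (hK : ∀ K : Lvl, Kof' (eL K) = (Kof K).map φ.toMonoidHom)
    (heH : ∀ (g : G) (x : D.H), eH (MonoidAlgebra.of ℂ G g • x) = MonoidAlgebra.of ℂ G' (φ g) • eH x)
    (hPhi : ∀ μ : D.Char, D.PhiMu μ ↔ D'.PhiMu (eC μ))
    (hblock : ∀ μ : D.Char, (D.block μ).map (eH : D.H →ₛₗ[σ] D'.H) = D'.block (eC μ))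
    (hres : ∀ (K : Lvl) (x : D.H), x ∈ fixedBy (Kof K) D.H → eW K (res K x) = res' (eL K) (eH x))
    (hcm : ∀ (K : Lvl) (μ : D.Char), cmCl' (eL K) (eC μ) = eW K '' cmCl K μ) :
    D.Thm418Combined res cmCl ↔ D'.Thm418Combined res' cmCl' := by
  constructor
  · refine thm418Combined_semilinearTransport_of_fixed D D' res cmCl res' cmCl' φ eL eC eC.surjective eH
      (fun K => (eW K : W K →ₛₗ[σ] W' (eL K))) (fun K k hk => ?_) (fun K k _ x => heH k x)
      (fun μ => (hPhi μ).2) (fun μ => (hblock μ).ge) (fun K x hx => hres K x hx) (fun K μ => (hcm K μ).ge)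
    rw [hK K]
    exact ⟨k, hk, rfl⟩
  · refine thm418Combined_of_semilinearTransport_fixed D D' res cmCl res' cmCl' φ eL eC (eH : D.H →ₛₗ[σ] D'.H)
      (fun K => (eW K : W K →ₛₗ[σ] W' (eL K))) (fun K₀' => ⟨eL.symm K₀', fun K hK => ?_⟩) (fun K k' hk' => ?_)
      (fun K k _ x => heH k x) (fun μ => (hPhi μ).1) (fun μ => (hblock μ).le) (fun K x hx => hres K x hx)
      (fun K => (eW K).injective) (fun K μ => (hcm K μ).le)
    · simpa using eL.monotone hK
    · rw [hK K] at hk'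
      obtain ⟨k, hk, rfl⟩ := hk'
      exact ⟨k, hk, rfl⟩

end AbstractSemilinearFixed

end HodgeCM.Literature.Theta.LiuAlbaneseModuleDatum.D2Bridge

namespace Summit.HodgeConjecture.CorCM.D2Bridge

open HodgeCM HodgeCM.Model
open HodgeCM.Literature.Theta HodgeCM.Literature.Theta.LiuAlbaneseModuleDatum
open HodgeCM.Literature.Theta.LiuAlbaneseModuleDatum.D2Bridge

variable {σ σ' : ℂ →+* ℂ} [RingHomInvPair σ σ'] [RingHomInvPair σ' σ]
variable {hHD : Literature.AlgebraicGeometry.HodgeTheory.exists_isReal_hodgeModel}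
  {hI : Literature.AlgebraicGeometry.HodgeTheory.hodgePQ_independent_of_hodgeModel}
  {h₁ : Literature.NumberTheory.Automorphic.PicardCM.BallQuotientUniformised}
  {h₃ : Literature.NumberTheory.Automorphic.PicardCM.CMAbelianVarietyRealised}

/-- **`Thm418C` transports along a SEMILINEAR package (two-sided, any two pins), WEAK `res`-law**: as
`thm418C_iff_of_semilinearTransport`, but `hres` only on `K.K`-fixed vectors of the tower — the form a tower-built `eH` (e.g. `F∞`)
actually satisfies at the model. [folklore] -/
theorem thm418C_iff_of_semilinearTransport_fixed {L₁ L₂ : HodgeCM.CMField} {ι₁ : (L₁ : Type) →+* ℂ} {ι₂ : (L₂ : Type) →+* ℂ}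
    {V₁ : HodgeCM.HermSpace3 L₁ ι₁} {V₂ : HodgeCM.HermSpace3 L₂ ι₂}
    (T₁ : LiuDictionary hHD hI h₁ h₃ V₁) (T₂ : LiuDictionary hHD hI h₁ h₃ V₂)
    (φ : ↥V₁.adelicFin ≃* ↥V₂.adelicFin) (eL : HodgeCM.Level V₁ ≃o HodgeCM.Level V₂) (eC : T₁.Char ≃ T₂.Char)
    (eH : T₁.H ≃ₛₗ[σ] T₂.H)
    (eW : ∀ K : HodgeCM.Level V₁,
      (picardCMUniverse hHD hI h₁ h₃).CohC ((picardCMUniverse hHD hI h₁ h₃).pms L₁ ι₁ V₁ K) 1 ≃ₛₗ[σ]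
        (picardCMUniverse hHD hI h₁ h₃).CohC ((picardCMUniverse hHD hI h₁ h₃).pms L₂ ι₂ V₂ (eL K)) 1)
    (hK : ∀ K : HodgeCM.Level V₁, (eL K).K = K.K.map φ.toMonoidHom)
    (heH : ∀ (g : ↥V₁.adelicFin) (x : T₁.H),
      eH (MonoidAlgebra.of ℂ ↥V₁.adelicFin g • x) = MonoidAlgebra.of ℂ ↥V₂.adelicFin (φ g) • eH x)
    (hPhi : ∀ μ : T₁.Char, T₁.PhiMu μ ↔ T₂.PhiMu (eC μ))
    (hblock : ∀ μ : T₁.Char, (T₁.block μ).map (eH : T₁.H →ₛₗ[σ] T₂.H) = T₂.block (eC μ))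
    (hres : ∀ (K : HodgeCM.Level V₁) (x : T₁.H), x ∈ fixedBy K.K T₁.H → eW K (T₁.res K x) = T₂.res (eL K) (eH x))
    (hcm : ∀ (K : HodgeCM.Level V₁) (μ : T₁.Char), T₂.cmClasses (eL K) (eC μ) = eW K '' T₁.cmClasses K μ) :
    T₁.Thm418C ↔ T₂.Thm418C :=
  thm418Combined_iff_of_semilinearTransport_fixed T₁.toLiuAlbaneseModuleDatum T₂.toLiuAlbaneseModuleDatum T₁.res T₁.cmClasses T₂.res
    T₂.cmClasses φ eL eC eH eW hK heH hPhi hblock hres hcm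

omit [RingHomInvPair σ' σ] in
/-- **`Thm418C` transports along a SEMILINEAR package (one-sided, consumer's direction), WEAK `res`-law**: as
`thm418C_of_semilinearTransport` with `hres` only on `K.K`-fixed vectors. [folklore] -/
theorem thm418C_of_semilinearTransport_fixed {L₁ L₂ : HodgeCM.CMField} {ι₁ : (L₁ : Type) →+* ℂ} {ι₂ : (L₂ : Type) →+* ℂ}
    {V₁ : HodgeCM.HermSpace3 L₁ ι₁} {V₂ : HodgeCM.HermSpace3 L₂ ι₂}
    (T₁ : LiuDictionary hHD hI h₁ h₃ V₁) (T₂ : LiuDictionary hHD hI h₁ h₃ V₂)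
    (φ : ↥V₁.adelicFin → ↥V₂.adelicFin) (eL : HodgeCM.Level V₁ → HodgeCM.Level V₂) (eC : T₁.Char → T₂.Char)
    (eH : T₁.H →ₛₗ[σ] T₂.H)
    (eW : ∀ K : HodgeCM.Level V₁,
      (picardCMUniverse hHD hI h₁ h₃).CohC ((picardCMUniverse hHD hI h₁ h₃).pms L₁ ι₁ V₁ K) 1 →ₛₗ[σ]
        (picardCMUniverse hHD hI h₁ h₃).CohC ((picardCMUniverse hHD hI h₁ h₃).pms L₂ ι₂ V₂ (eL K)) 1)
    (hcof : ∀ K₀' : HodgeCM.Level V₂, ∃ K₀ : HodgeCM.Level V₁, ∀ K ≤ K₀, eL K ≤ K₀')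
    (hK : ∀ (K : HodgeCM.Level V₁), ∀ k' ∈ (eL K).K, ∃ k ∈ K.K, φ k = k')
    (heH : ∀ (K : HodgeCM.Level V₁), ∀ k ∈ K.K, ∀ x : T₁.H,
      eH (MonoidAlgebra.of ℂ ↥V₁.adelicFin k • x) = MonoidAlgebra.of ℂ ↥V₂.adelicFin (φ k) • eH x)
    (hPhi : ∀ μ : T₁.Char, T₁.PhiMu μ → T₂.PhiMu (eC μ))
    (hblock : ∀ μ : T₁.Char, (T₁.block μ).map eH ≤ T₂.block (eC μ))
    (hres : ∀ (K : HodgeCM.Level V₁) (x : T₁.H), x ∈ fixedBy K.K T₁.H → eW K (T₁.res K x) = T₂.res (eL K) (eH x))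
    (hW : ∀ K : HodgeCM.Level V₁, Function.Injective (eW K))
    (hcm : ∀ (K : HodgeCM.Level V₁) (μ : T₁.Char), T₂.cmClasses (eL K) (eC μ) ⊆ eW K '' T₁.cmClasses K μ)
    (h : T₂.Thm418C) : T₁.Thm418C :=
  thm418Combined_of_semilinearTransport_fixed T₁.toLiuAlbaneseModuleDatum T₂.toLiuAlbaneseModuleDatum T₁.res T₁.cmClasses T₂.res
    T₂.cmClasses φ eL eC eH eW hcof hK heH hPhi hblock hres hW hcm h

/-- **`Thm418C` transports along a SEMILINEAR package ON ONE HERMITIAN SPACE, WEAK `res`-law** (the Track-T ∕ `F∞` shape: `φ = id`,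
`eL = id`; `hres` only on `K.K`-fixed vectors, where a tower-built `eH` satisfies it): as `thm418C_iff_of_semilinearTransport_samePin`.
[folklore] -/
theorem thm418C_iff_of_semilinearTransport_samePin_fixed {L : HodgeCM.CMField} {ι₁ : (L : Type) →+* ℂ}
    {V : HodgeCM.HermSpace3 L ι₁}
    (T₁ T₂ : LiuDictionary hHD hI h₁ h₃ V) (eC : T₁.Char ≃ T₂.Char) (eH : T₁.H ≃ₛₗ[σ] T₂.H)
    (eW : ∀ K : HodgeCM.Level V,
      (picardCMUniverse hHD hI h₁ h₃).CohC ((picardCMUniverse hHD hI h₁ h₃).pms L ι₁ V K) 1 ≃ₛₗ[σ]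
        (picardCMUniverse hHD hI h₁ h₃).CohC ((picardCMUniverse hHD hI h₁ h₃).pms L ι₁ V K) 1)
    (heH : ∀ (g : ↥V.adelicFin) (x : T₁.H),
      eH (MonoidAlgebra.of ℂ ↥V.adelicFin g • x) = MonoidAlgebra.of ℂ ↥V.adelicFin g • eH x)
    (hPhi : ∀ μ : T₁.Char, T₁.PhiMu μ ↔ T₂.PhiMu (eC μ))
    (hblock : ∀ μ : T₁.Char, (T₁.block μ).map (eH : T₁.H →ₛₗ[σ] T₂.H) = T₂.block (eC μ))
    (hres : ∀ (K : HodgeCM.Level V) (x : T₁.H), x ∈ fixedBy K.K T₁.H → eW K (T₁.res K x) = T₂.res K (eH x))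
    (hcm : ∀ (K : HodgeCM.Level V) (μ : T₁.Char), T₂.cmClasses K (eC μ) = eW K '' T₁.cmClasses K μ) :
    T₁.Thm418C ↔ T₂.Thm418C :=
  thm418C_iff_of_semilinearTransport_fixed T₁ T₂ (MulEquiv.refl _) (OrderIso.refl _) eC eH eW (fun K => by ext g; simp)
    (fun g x => heH g x) hPhi hblock (fun K x hx => hres K x hx) hcm

end Summit.HodgeConjecture.CorCM.D2Bridge

end
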